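import Summits.Parity.GeneralizedHardyLittlewood.Theorems.LeeYangFibresRelativeDimOneTypeDataB
import Summits.Parity.GeneralizedHardyLittlewood.Theorems.LeeYangFibresRelativeDimOneTypeEndgame
import HarnessLib

/-!
# Type data for the reshaped line `gallagher-backwards-split` (crux stmt-Parity-14113
`LeeYangFibres.RelativeDimOne`, stub `stub_typeData`), PART E: estimates for the assembly

* `combine` (registered hook `typeData_combine`): the final real-arithmetic step — from the prime side
  `Σ S = x^t K N λ (1 ± ε₁(1 + 1/λ))`, the spectrum side `Σ F = K x^t condSum ± 2tKQ(x+Q)^{t−1} R`,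
  `Σ |F| ≤ K (x+Q)^t R`, `#(cell ∩ box) ≤ K (x+1)^t`, the summed core clause
  `|Σ S − (N−1) Σ F| ≤ ε((N−1) Σ|F| + N #)` and `R ≤ 2 C G`, `0 ≤ λ ≤ G`, `1 ≤ G`, `Q ≤ (η-small)·x`:
  `|condSum − λ| ≤ η G`;
* the summed core clause (`core_summed`), the scales (`primorial_wlev_le_rpow`, `level_mul_primorial_le`),
  and the weights (`singularProductPartial_le_gscale`, `localTypeFactor_primorial`; `1 ≤ G_w` is the landed
  `EndgameProof.one_le_gscale`).
-/

noncomputable section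

open scoped BigOperators Classical ArithmeticFunction.vonMangoldt
open Finset Filter Literature.NumberTheory.Sieve
open Summit.Parity.GeneralizedHardyLittlewood.Cruxes.RelativeDimOne.GallagherBackwards (classPsi)
open Summit.Parity.GeneralizedHardyLittlewood.Cruxes.RelativeDimOne.GallagherBackwardsSplit

namespace Summit.Parity.GeneralizedHardyLittlewood.Cruxes.RelativeDimOne.TypeSplit

namespace TypeDataProof

variable {t : ℕ}

/-! ### The final real-arithmetic step -/

/-- COMBINATION of the prime side, the spectrum side and the summed core clause (pure real arithmetic). -/
theorem combine (ht : 1 ≤ t) {Spr Ssp Sabs cnt cs lam G R K x Nr Q ε ε₁ C η : ℝ}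
    (hK : 0 < K) (hx : 1 ≤ x) (hQ0 : 0 ≤ Q) (hQx : Q ≤ x) (hNr : 2 ≤ Nr) (hε : 0 ≤ ε)
    (hε₁ : 0 ≤ ε₁) (hG : 1 ≤ G) (hlam0 : 0 ≤ lam) (hlamG : lam ≤ G) (hR0 : 0 ≤ R)
    (hR : R ≤ 2 * C * G)
    (h1 : |Spr - x ^ t * K * Nr * lam| ≤ ε₁ * (x ^ t * K * Nr * (lam + 1)))
    (h2 : |Ssp - K * x ^ t * cs| ≤ 2 * t * K * Q * (x + Q) ^ (t - 1) * R)
    (h3 : Sabs ≤ K * (x + Q) ^ t * R) (h4 : cnt ≤ K * (x + 1) ^ t)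
    (h5 : |Spr - (Nr - 1) * Ssp| ≤ ε * ((Nr - 1) * Sabs + Nr * cnt))
    (hεη : ε * (2 ^ (t + 1) * (C + 1)) ≤ η / 4) (hδ : t * 2 ^ (t + 1) * C * Q ≤ η / 4 * x)
    (hNη : 4 ≤ η * (Nr - 1)) (hε₁η : 16 * ε₁ ≤ η) :
    |cs - lam| ≤ η * G := by
  have hx0 : 0 < x := by linarith
  have hNr1 : 0 < Nr - 1 := by linarith
  have hG0 : 0 ≤ G := by linarith
  set W := (Nr - 1) * K * x ^ t with hW
  have hW0 : 0 < W := by positivity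
  -- the identity behind the combination
  have key : W * (cs - lam) = (Nr - 1) * (K * x ^ t * cs - Ssp) - (Spr - (Nr - 1) * Ssp)
      + (Spr - x ^ t * K * Nr * lam) + x ^ t * K * lam := by
    rw [hW]; ring
  have hb : |W * (cs - lam)| ≤ (Nr - 1) * (2 * t * K * Q * (x + Q) ^ (t - 1) * R)
      + ε * ((Nr - 1) * Sabs + Nr * cnt) + ε₁ * (x ^ t * K * Nr * (lam + 1)) + x ^ t * K * lam := by
    rw [key]
    have e2 : |(Nr - 1) * (K * x ^ t * cs - Ssp)| ≤ (Nr - 1) * (2 * t * K * Q * (x + Q) ^ (t - 1) * R) := by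
      rw [abs_mul, abs_of_pos hNr1, abs_sub_comm]
      exact mul_le_mul_of_nonneg_left h2 hNr1.le
    have e5 : |x ^ t * K * lam| = x ^ t * K * lam := abs_of_nonneg (by positivity)
    calc |(Nr - 1) * (K * x ^ t * cs - Ssp) - (Spr - (Nr - 1) * Ssp) + (Spr - x ^ t * K * Nr * lam)
            + x ^ t * K * lam|
        ≤ |(Nr - 1) * (K * x ^ t * cs - Ssp) - (Spr - (Nr - 1) * Ssp) + (Spr - x ^ t * K * Nr * lam)|
            + |x ^ t * K * lam| := abs_add_le _ _
      _ ≤ |(Nr - 1) * (K * x ^ t * cs - Ssp) - (Spr - (Nr - 1) * Ssp)| + |Spr - x ^ t * K * Nr * lam|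
            + |x ^ t * K * lam| := by gcongr; exact abs_add_le _ _
      _ ≤ |(Nr - 1) * (K * x ^ t * cs - Ssp)| + |Spr - (Nr - 1) * Ssp| + |Spr - x ^ t * K * Nr * lam|
            + |x ^ t * K * lam| := by gcongr; exact abs_sub _ _
      _ ≤ _ := by rw [e5]; linarith [e2, h5, h1]
  -- elementary power bounds
  have hxQ : x + Q ≤ 2 * x := by linarith
  have hp1 : (x + Q) ^ (t - 1) ≤ 2 ^ (t - 1) * x ^ (t - 1) := by
    rw [← mul_pow]; exact pow_le_pow_left₀ (by positivity) hxQ _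
  have hp2 : (x + Q) ^ t ≤ 2 ^ t * x ^ t := by
    rw [← mul_pow]; exact pow_le_pow_left₀ (by positivity) hxQ _
  have hp3 : (x + 1) ^ t ≤ 2 ^ t * x ^ t := by
    rw [← mul_pow]; exact pow_le_pow_left₀ (by positivity) (by linarith) _
  have hxt : x ^ t = x ^ (t - 1) * x := by
    conv_lhs => rw [← Nat.sub_add_cancel ht, pow_succ]
  have h2t : (2 : ℝ) ^ (t + 1) = 2 ^ (t - 1) * 4 := by
    conv_lhs => rw [← Nat.sub_add_cancel ht, pow_succ, pow_succ]
    ring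
  have h2t' : (2 : ℝ) ^ (t + 1) = 2 ^ t * 2 := pow_succ _ _
  -- (i) the residue-counting error
  have i1 : (Nr - 1) * (2 * t * K * Q * (x + Q) ^ (t - 1) * R) ≤ η / 4 * (W * G) := by
    have s1 : (Nr - 1) * (2 * t * K * Q * (x + Q) ^ (t - 1) * R)
        ≤ (Nr - 1) * (2 * t * K * Q * (2 ^ (t - 1) * x ^ (t - 1)) * (2 * C * G)) := by
      gcongr
    have s2 : (Nr - 1) * (2 * t * K * Q * (2 ^ (t - 1) * x ^ (t - 1)) * (2 * C * G))
        = (Nr - 1) * K * x ^ (t - 1) * G * (t * 2 ^ (t + 1) * C * Q) := by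
      rw [h2t]; ring
    have s3 : (Nr - 1) * K * x ^ (t - 1) * G * (t * 2 ^ (t + 1) * C * Q)
        ≤ (Nr - 1) * K * x ^ (t - 1) * G * (η / 4 * x) :=
      mul_le_mul_of_nonneg_left hδ (by positivity)
    have s4 : (Nr - 1) * K * x ^ (t - 1) * G * (η / 4 * x) = η / 4 * (W * G) := by
      rw [hW, hxt]; ring
    linarith
  -- (ii) + (iii) the core error
  have i2 : ε * ((Nr - 1) * Sabs + Nr * cnt) ≤ η / 4 * (W * G) := by
    have s1 : (Nr - 1) * Sabs ≤ (Nr - 1) * (K * (2 ^ t * x ^ t) * (2 * C * G)) := by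
      apply mul_le_mul_of_nonneg_left _ hNr1.le
      calc Sabs ≤ K * (x + Q) ^ t * R := h3
        _ ≤ K * (2 ^ t * x ^ t) * (2 * C * G) := by gcongr
    have hcnt : cnt ≤ K * (2 ^ t * x ^ t) * G := by
      calc cnt ≤ K * (x + 1) ^ t := h4
        _ ≤ K * (2 ^ t * x ^ t) := by gcongr
        _ = K * (2 ^ t * x ^ t) * 1 := (mul_one _).symm
        _ ≤ K * (2 ^ t * x ^ t) * G := by gcongr
    have s2 : Nr * cnt ≤ (2 * (Nr - 1)) * (K * (2 ^ t * x ^ t) * G) := by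
      calc Nr * cnt ≤ Nr * (K * (2 ^ t * x ^ t) * G) := mul_le_mul_of_nonneg_left hcnt (by linarith)
        _ ≤ (2 * (Nr - 1)) * (K * (2 ^ t * x ^ t) * G) :=
            mul_le_mul_of_nonneg_right (by linarith) (by positivity)
    have s12 : ε * ((Nr - 1) * Sabs + Nr * cnt) ≤
        ε * ((Nr - 1) * (K * (2 ^ t * x ^ t) * (2 * C * G)) + (2 * (Nr - 1)) * (K * (2 ^ t * x ^ t) * G)) :=
      mul_le_mul_of_nonneg_left (add_le_add s1 s2) hε
    have s3 : ε * ((Nr - 1) * (K * (2 ^ t * x ^ t) * (2 * C * G)) + (2 * (Nr - 1)) * (K * (2 ^ t * x ^ t) * G))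
        = ε * (2 ^ (t + 1) * (C + 1)) * (W * G) := by
      rw [hW, h2t']; ring
    have s4 : ε * (2 ^ (t + 1) * (C + 1)) * (W * G) ≤ η / 4 * (W * G) :=
      mul_le_mul_of_nonneg_right hεη (by positivity)
    linarith
  -- (iv) the prime-side error
  have i4 : ε₁ * (x ^ t * K * Nr * (lam + 1)) ≤ η / 4 * (W * G) := by
    have s1 : x ^ t * K * Nr * (lam + 1) ≤ x ^ t * K * (2 * (Nr - 1)) * (2 * G) := by
      gcongr
      · linarith
      · linarith
    have s1' : ε₁ * (x ^ t * K * Nr * (lam + 1)) ≤ ε₁ * (x ^ t * K * (2 * (Nr - 1)) * (2 * G)) :=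
      mul_le_mul_of_nonneg_left s1 hε₁
    have s2 : ε₁ * (x ^ t * K * (2 * (Nr - 1)) * (2 * G)) = (16 * ε₁) / 4 * (W * G) := by
      rw [hW]; ring
    have s3 : (16 * ε₁) / 4 * (W * G) ≤ η / 4 * (W * G) := by gcongr
    linarith
  -- (v) the normalisation `N/(N−1)`
  have i5 : x ^ t * K * lam ≤ η / 4 * (W * G) := by
    have s1 : x ^ t * K * lam ≤ x ^ t * K * G := by gcongr
    have s2 : x ^ t * K * G = 4 / 4 * (x ^ t * K * G) := by ring
    have s3 : 4 / 4 * (x ^ t * K * G) ≤ (η * (Nr - 1)) / 4 * (x ^ t * K * G) := by gcongr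
    have s4 : (η * (Nr - 1)) / 4 * (x ^ t * K * G) = η / 4 * (W * G) := by rw [hW]; ring
    linarith
  -- conclusion
  have hfin : |W * (cs - lam)| ≤ η * (W * G) := by linarith
  rw [abs_mul, abs_of_pos hW0] at hfin
  have : |cs - lam| ≤ η * G := by
    have h' : W * |cs - lam| ≤ W * (η * G) := by linarith
    exact le_of_mul_le_mul_left h' hW0
  exact this

/-- Registered hook (aux for `stub_typeData`): the combination step. -/
theorem typeData_combine : ∀ {t : ℕ}, 1 ≤ t → ∀ {Spr Ssp Sabs cnt cs lam G R K x Nr Q ε ε₁ C η : ℝ}, 0 < K → 1 ≤ x → 0 ≤ Q → Q ≤ x → 2 ≤ Nr → 0 ≤ ε → 0 ≤ ε₁ → 1 ≤ G → 0 ≤ lam → lam ≤ G → 0 ≤ R → R ≤ 2 * C * G → |Spr - x ^ t * K * Nr * lam| ≤ ε₁ * (x ^ t * K * Nr * (lam + 1)) → |Ssp - K * x ^ t * cs| ≤ 2 * t * K * Q * (x + Q) ^ (t - 1) * R → Sabs ≤ K * (x + Q) ^ t * R → cnt ≤ K * (x + 1) ^ t → |Spr - (Nr - 1) * Ssp| ≤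 ε * ((Nr - 1) * Sabs + Nr * cnt) → ε * (2 ^ (t + 1) * (C + 1)) ≤ η / 4 → t * 2 ^ (t + 1) * C * Q ≤ η / 4 * x → 4 ≤ η * (Nr - 1) → 16 * ε₁ ≤ η → |cs - lam| ≤ η * G :=
  fun ht _ _ _ _ _ _ _ _ _ _ _ _ _ _ _ _ hK hx hQ0 hQx hNr hε hε₁ hG hlam0 hlamG hR0 hR h1 h2 h3 h4 h5 hεη hδ hNη hε₁η =>
    combine ht hK hx hQ0 hQx hNr hε hε₁ hG hlam0 hlamG hR0 hR h1 h2 h3 h4 h5 hεη hδ hNη hε₁η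

/-! ### The summed core clause -/

/-- THE CORE CLAUSE SUMMED over a set of shift vectors of the data box (window `[0, N − 1]`, `β_∞ = N − 1`):
`|Σ_b S(sys a b) − (N−1) Σ_b F(b)| ≤ ε ((N−1) Σ_b |F(b)| + N #)`, `F(b) = sfBand ⌊N^θ⌋ (f a) b`. -/
theorem core_summed {θ ε : ℝ} {L N : ℕ} (hN : 1 ≤ N)
    {f : (Fin t → ℤ) → ℕ → (Fin t → ℤ) → ℝ} (hCore : CoreApprox θ t (t * ((2 * L + 2) ^ t + L + 1)) N ε f)
    {a : Fin t → ℤ} (ha : ∀ i, a i ≠ 0 ∧ |a i| ≤ L) (Bc : Finset (Fin t → ℤ))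
    (hBc : Bc ⊆ box (fun i => (((2 * L + 2) ^ (i.val + 1) * N : ℕ) : ℤ)) (fun _ => N)) :
    |∑ b ∈ Bc, ∑ n ∈ range N, ∏ i, Λ ((a i * n + b i).toNat)
        - ((N : ℝ) - 1) * ∑ b ∈ Bc, sfBand (level θ N) (f a) b|
      ≤ ε * (((N : ℝ) - 1) * ∑ b ∈ Bc, |sfBand (level θ N) (f a) b| + N * Bc.card) := by
  have hper : ∀ b ∈ Bc, |∑ n ∈ range N, ∏ i, Λ ((a i * n + b i).toNat)
      - ((N : ℝ) - 1) * sfBand (level θ N) (f a) b|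
        ≤ ε * (((N : ℝ) - 1) * |sfBand (level θ N) (f a) b| + N) := by
    intro b hb
    have hbB := hBc hb
    have h1 := hCore (sys a b) (nondeg_of_mem_box ha hbB hN) (affLinSize_le_of_mem_box ha hbB hN)
      (Set.Icc (fun _ => (0 : ℝ)) (fun _ => (N : ℝ) - 1)) (convex_window N) (window_subset_realBox (Nat.le_succ N))
    rw [vonMangoldtSum_sys_window a b (Nat.le_succ N),
      archFactor_sys_window a b hN (pos_on_window_of_mem_box ha hbB), coeffs_sys, consts_sys] at h1
    exact h1
  calc |∑ b ∈ Bc, ∑ n ∈ range N, ∏ i, Λ ((a i * n + b i).toNat)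
          - ((N : ℝ) - 1) * ∑ b ∈ Bc, sfBand (level θ N) (f a) b|
      = |∑ b ∈ Bc, (∑ n ∈ range N, ∏ i, Λ ((a i * n + b i).toNat)
          - ((N : ℝ) - 1) * sfBand (level θ N) (f a) b)| := by
        rw [Finset.sum_sub_distrib, Finset.mul_sum]
    _ ≤ ∑ b ∈ Bc, |∑ n ∈ range N, ∏ i, Λ ((a i * n + b i).toNat)
          - ((N : ℝ) - 1) * sfBand (level θ N) (f a) b| := Finset.abs_sum_le_sum_abs _ _
    _ ≤ ∑ b ∈ Bc, ε * (((N : ℝ) - 1) * |sfBand (level θ N) (f a) b| + N) := Finset.sum_le_sum hper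
    _ = ε * (((N : ℝ) - 1) * ∑ b ∈ Bc, |sfBand (level θ N) (f a) b| + N * Bc.card) := by
        rw [← Finset.mul_sum, Finset.sum_add_distrib, ← Finset.mul_sum, Finset.sum_const, nsmul_eq_mul]
        ring

/-! ### Scales -/

/-- `∏_{p ≤ w} p ≤ N^{1/D}` for the conditioning height `w = ⌊log₄ N⌋ / D`. -/
theorem primorial_wlev_le_rpow {N D : ℕ} (hN : 1 ≤ N) (hD : 1 ≤ D) :
    ((primorial (wlev D N) : ℕ) : ℝ) ≤ (N : ℝ) ^ (1 / (D : ℝ)) := by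
  have h1 : primorial (wlev D N) ^ D ≤ N := by
    calc primorial (wlev D N) ^ D ≤ (4 ^ wlev D N) ^ D :=
          Nat.pow_le_pow_left (primorial_le_four_pow _) D
      _ = 4 ^ (wlev D N * D) := by rw [← pow_mul]
      _ ≤ 4 ^ Nat.log 4 N := Nat.pow_le_pow_right (by norm_num) (Nat.div_mul_le_self _ _)
      _ ≤ N := Nat.pow_log_le_self 4 (by omega)
  have h2 : ((primorial (wlev D N) : ℕ) : ℝ) ^ D ≤ (N : ℝ) := by exact_mod_cast h1
  have h3 : (0 : ℝ) ≤ ((primorial (wlev D N) : ℕ) : ℝ) := Nat.cast_nonneg _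
  calc ((primorial (wlev D N) : ℕ) : ℝ)
      = ((((primorial (wlev D N) : ℕ) : ℝ)) ^ D) ^ ((D : ℝ)⁻¹) :=
        (Real.pow_rpow_inv_natCast h3 (by omega)).symm
    _ ≤ (N : ℝ) ^ ((D : ℝ)⁻¹) := Real.rpow_le_rpow (by positivity) h2 (by positivity)
    _ = (N : ℝ) ^ (1 / (D : ℝ)) := by rw [one_div]

/-- `⌊N^θ⌋ ≤ N^θ`. -/
theorem level_le_rpow (θ : ℝ) (N : ℕ) : ((level θ N : ℕ) : ℝ) ≤ (N : ℝ) ^ θ :=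
  Nat.floor_le (Real.rpow_nonneg (Nat.cast_nonneg N) θ)

/-- The product of the level and the cell modulus is `o(N)`: `⌊N^θ⌋ · ∏_{p ≤ w} p ≤ (N + 1) N^{−(1−θ)/2}` once
`1/D ≤ (1 − θ)/2`. -/
theorem level_mul_primorial_le {θ : ℝ} {N D : ℕ} (hN : 1 ≤ N) (hD : 1 ≤ D) (hDθ : 1 / (D : ℝ) ≤ (1 - θ) / 2) :
    ((level θ N : ℕ) : ℝ) * ((primorial (wlev D N) : ℕ) : ℝ) ≤
      (((N + 1 : ℕ)) : ℝ) * (N : ℝ) ^ (-((1 - θ) / 2)) := by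
  have hN' : (1 : ℝ) ≤ N := by exact_mod_cast hN
  have hN0 : (0 : ℝ) < N := by linarith
  calc ((level θ N : ℕ) : ℝ) * ((primorial (wlev D N) : ℕ) : ℝ)
      ≤ (N : ℝ) ^ θ * (N : ℝ) ^ (1 / (D : ℝ)) :=
        mul_le_mul (level_le_rpow θ N) (primorial_wlev_le_rpow hN hD) (Nat.cast_nonneg _)
          (Real.rpow_nonneg hN0.le θ)
    _ = (N : ℝ) ^ (θ + 1 / (D : ℝ)) := (Real.rpow_add hN0 _ _).symm
    _ ≤ (N : ℝ) ^ (1 + -((1 - θ) / 2)) := Real.rpow_le_rpow_of_exponent_le hN' (by linarith)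
    _ = (N : ℝ) * (N : ℝ) ^ (-((1 - θ) / 2)) := by rw [Real.rpow_add hN0, Real.rpow_one]
    _ ≤ (((N + 1 : ℕ)) : ℝ) * (N : ℝ) ^ (-((1 - θ) / 2)) := by
        apply mul_le_mul_of_nonneg_right _ (Real.rpow_nonneg hN0.le _)
        push_cast
        linarith

/-! ### Weights -/

/-- The local type factor at the cell modulus is the partial singular product `∏_{p ≤ w} β_p`. -/
theorem localTypeFactor_primorial (w : ℕ) (a b₀ : Fin t → ℤ) :
    localTypeFactor (primorial w) a b₀ = singularProductPartial (sys a b₀) w := by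
  unfold localTypeFactor singularProductPartial
  rw [primorial_eq_prod_primesLE, Nat.primeFactors_prod (fun p hp => (Nat.mem_primesLE.1 hp).2)]

/-- `0 ≤ ∏_{p ≤ w} β_p`. -/
theorem singularProductPartial_nonneg (w : ℕ) (a b₀ : Fin t → ℤ) : 0 ≤ singularProductPartial (sys a b₀) w :=
  Finset.prod_nonneg fun _ _ => localFactor_nonneg _ _

/-- `∏_{p ≤ w} β_p ≤ G_w(a, b₀)`. -/
theorem singularProductPartial_le_gscale (w : ℕ) (a b₀ : Fin t → ℤ) :
    singularProductPartial (sys a b₀) w ≤ gscale w a b₀ := by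
  unfold singularProductPartial gscale
  refine Finset.prod_le_prod (fun _ _ => localFactor_nonneg _ _) fun p _ => ?_
  unfold wt
  have h1 := le_abs_self (localFactor (sys a b₀) p - 1)
  have h2 : (0 : ℝ) ≤ (t : ℝ) ^ 2 / (p : ℝ) ^ 2 := by positivity
  linarith

/-- `|condAvg g| ≤ condAvg |g|`. -/
theorem abs_condAvg_le (q w : ℕ) (a b₀ : Fin t → ℤ) (g : (Fin t → ℤ) → ℝ) :
    |condAvg q w a b₀ g| ≤ condAvg q w a b₀ (fun b => |g b|) := by
  unfold condAvg
  rw [abs_div, Nat.abs_cast]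
  exact div_le_div_of_nonneg_right (Finset.abs_sum_le_sum_abs _ _) (Nat.cast_nonneg _)

/-- `0 ≤ condAvg |g|`. -/
theorem condAvg_abs_nonneg (q w : ℕ) (a b₀ : Fin t → ℤ) (g : (Fin t → ℤ) → ℝ) :
    0 ≤ condAvg q w a b₀ (fun b => |g b|) :=
  div_nonneg (Finset.sum_nonneg fun _ _ => abs_nonneg _) (Nat.cast_nonneg _)

/-- The heights of the moving windows of the data box, in the form `TypeClassMoments` consumes (`δ = 1`). -/
theorem heights_real {L N : ℕ} {a : Fin t → ℤ} (ha : ∀ i, a i ≠ 0 ∧ |a i| ≤ L) :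
    ∀ i, ∀ n : ℕ, n < N →
      (1 : ℝ) * N + 1 ≤ ((a i * n + (((2 * L + 2) ^ (i.val + 1) * N : ℕ) : ℤ) : ℤ) : ℝ) ∧
        ((a i * n + (((2 * L + 2) ^ (i.val + 1) * N : ℕ) : ℤ) + (N : ℕ) : ℤ) : ℝ)
          ≤ ((((2 * L + 2) ^ t + L + 1 : ℕ)) : ℝ) * N := by
  intro i n hn
  obtain ⟨h1, h2⟩ := heights_of_window (t := t) ha i n hn
  constructor
  · have h1' : (((N : ℤ) + 1 : ℤ) : ℝ) ≤ ((a i * n + (((2 * L + 2) ^ (i.val + 1) * N : ℕ) : ℤ) : ℤ) : ℝ) := by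
      exact_mod_cast h1
    push_cast at h1' ⊢
    linarith
  · have h2' : ((a i * n + (((2 * L + 2) ^ (i.val + 1) * N : ℕ) : ℤ) + (N : ℕ) : ℤ) : ℝ)
        ≤ (((((2 * L + 2) ^ t + L + 1 : ℕ)) : ℤ) * (N : ℤ) : ℝ) := by
      exact_mod_cast h2
    push_cast at h2' ⊢
    linarith

end TypeDataProof

end Summit.Parity.GeneralizedHardyLittlewood.Cruxes.RelativeDimOne.TypeSplit

end
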